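import Summits.BirchSwinnertonDyer.BirchSwinnertonDyer.Theorems.EisensteinPrimesBSDpOnCellCTelescopeK2BigRepInertiaInvariants
import Summits.BirchSwinnertonDyer.BirchSwinnertonDyer.Theorems.EisensteinPrimesBSDpOnCellCTelescopeK2HOneUnramifiedOfInvariants
import Summits.BirchSwinnertonDyer.BirchSwinnertonDyer.Theorems.EisensteinPrimesBSDpOnCellCTelescopeK2RepDescent
import Summits.BirchSwinnertonDyer.BirchSwinnertonDyer.Theorems.EisensteinPrimesBSDpOnCellCTelescopeK2SelmerDictionary
import Literature.NumberTheory.IwasawaTheory.Greenberg2006.CoinducedModuleDual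
import HarnessLib

/-!
# Crux 4 `BSDpOnCellC` (stmt-BirchSwinnertonDyer-19034), line «telescope», workfile `Lines/telescopeK2weight2.lean` v1.2,
# sub-leaf W4⁰ (`K2Weight2.stub_bigPseudoNullPTorsion`), route G′ input (ii′) AT THE INERTIA PLACES, BY NAME:
# **some `p^a · L_w` is almost `B`-divisible, `L_w = ker(H¹(K_w, 𝐃) → H¹(I_w, 𝐃))` the unramified local condition of
# Greenberg's specification `specOfIndexSet` (p747353) for `𝐃 = AnticyclotomicBigGaloisRep κ ρ` descended to `G_{K,S}`**
# (ideator seat `bsd-idea-12` gen 39; `--supports stmt-BirchSwinnertonDyer-19034 --as helper`; THEOREMS ONLY; closes nothing)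

HONEST FRAMING. No registered stub, no crux, no summit statement is proved here; BSD is proved for no curve. This file
only DOCKS three landed helpers: (M1)+(M2′)+(M2) `TelescopeK2BigRepInertiaInvariants.exists_isAlmostDivisible_map_lsmul_pow_of_inertia`
(the core `p^a · N` of ANY `B`-quotient `N` of `𝐃^{I_w}`, `w ∤ p`, is almost divisible once `𝐃` is cofinitely generated),
(M3) `TelescopeK2HOneUnramifiedOfInvariants.exists_linearMap_surjective_invariants_ker_Hpullback_localRep` (`𝐃^{I_w} ↠ L_w`
for discrete torsion coefficients) and (M4) the shape of `TelescopeK2SelmerDictionary.specOfIndexSet` at an inertia index,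
for the `G_{K,S}`-representation `TelescopeK2RepDescent.descendUnramified S (AnticyclotomicBigGaloisRep κ ρ) hS` (p746306).
The two spellings of "`𝐃` restricted to `I_w`" — Greenberg's `(localRep S ρ_S (Sum.inr w)).restrict (inertiaIncl K w)` and
the K2 kernel's `𝐃.restrict (localMap K (Sum.inr w))` — have the same underlying representation DEFINITIONALLY
(`restrict_localRep_descendUnramified_inertiaIncl`), which is what lets (M3)'s `π` feed (M1)+(M2′)+(M2).

* §1 `isOfFinAddOrder` — every element of `BigRepModule 𝒪 p A` has finite additive order (the landed
  `BigRepModule.exists_pow_nsmul_eq_zero`: the model is `p`-primary by construction), i.e. (M3)'s hypothesis `htors` is free here.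
* §2 `restrict_localRep_descendUnramified_inertiaIncl` — the docking identity of representations (by `rfl` on `toRepresentation`).
* §3 **`exists_isAlmostDivisible_map_lsmul_pow_ker_Hpullback`** — for `𝒪 = ℤ_p⟦X⟧`, `B = 𝒪⟦T⟧`, `κ` a `ℤ_p`-extension,
  `ρ : Γ_K → Aut_𝒪(A)` discrete with `𝐃 = BigRepModule 𝒪 p A` cofinitely generated over `B` (`hD`, = W1), `S` with
  `ramificationSubgroup K S ≤ ker 𝐃` (`hS`, p748872) and `w ∤ p`:
  `∃ a, IsAlmostDivisible B (p^a · ker (H¹(K_w, 𝐃) → H¹(I_w, 𝐃)))`.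
* §4 `specOfIndexSet_inr_of_not_mem_of_mem` — at `Sum.inr w ∈ L₀ ∌ Sum.inl w` the specification IS that kernel — and
  **`exists_isAlmostDivisible_map_lsmul_pow_specOfIndexSet_inr`**: the same for the `Sum.inr w` entry of `specOfIndexSet S ρ_S L₀`;
  in particular for `L₀ = strictSet p 𝔭̄ Σ` at every `w ∉ Σ`, `w ∤ p` (`inr_mem_strictSet_iff`) — route G′'s core datum
  `𝓛'_w = p^{a_w} 𝓛_w` with `𝓛'_w` almost divisible, at every inertia index of the K2 Selmer structure.

What (ii′) still needs OUTSIDE this file: nothing at the inertia indices; route G′'s remaining displayed inputs are the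
Greenberg-side rows (iii′) (Prop. 4.1.1(c) for the core specification — its CRK clause is that of `𝓛` by
`TelescopeK2CoreCRKTransfer.crk_iff_of_core`) and the `X₂ ↔ S_𝓛` duality (p747353 + `IsDualPairing`).

References: R. Greenberg, On the structure of Selmer groups (2016), §1 p. 3, §2.5, Remark 3.1.2, §4.2 [Greenberg2016Selmer];
R. Greenberg, On the structure of certain Galois cohomology groups, Doc. Math. Extra Vol. Coates (2006) 335–391, Prop. 2.4,
§3 A [Greenberg2006]; K. Rubin, Euler Systems (2000), Lemma 1.3.2, 1.3.5
[Rubin2000]; F. Castella, Camb. J. Math. 6 (2018), §2.1 [Castella2018].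
-/

set_option linter.dupNamespace false
set_option autoImplicit false

noncomputable section

open Function
open Field IsDedekindDomain NumberField
open Literature.NumberTheory.GaloisRepresentations Literature.NumberTheory.EllipticCurves
open Literature.NumberTheory.EllipticCurves.BigGaloisRep Literature.NumberTheory.IwasawaTheory
open scoped NumberField

universe u

namespace Summit.BirchSwinnertonDyer.BirchSwinnertonDyer.Theorems.TelescopeK2PurityCoreAtInertiaPlaces

/-! ## §1. `BigRepModule` is torsion -/

section Torsion

variable {𝒪 : Type u} [CommRing 𝒪] {p : ℕ} [Fact p.Prime] {A : Type u} [AddCommGroup A] [Module 𝒪 A]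

/-- Every element of the big module `𝐃 = Maps_sm(ℤ_p, A)_{p-prim}` has finite additive order ((M3)'s hypothesis
`htors`): it is killed by a power of `p` by construction — the landed `BigRepModule.exists_pow_nsmul_eq_zero`
(`Greenberg2006/CoinducedModuleDual.lean`), fed to (M3)'s `isOfFinAddOrder_of_pow_smul_eq_zero`. [cite: SkinnerUrban2014, §3.1.3] -/
theorem isOfFinAddOrder (Φ : BigRepModule 𝒪 p A) : IsOfFinAddOrder Φ :=
  TelescopeK2HOneUnramifiedOfInvariants.isOfFinAddOrder_of_pow_smul_eq_zero (Fact.out : p.Prime)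
    (BigRepModule.exists_pow_nsmul_eq_zero Φ)

end Torsion

/-! ## §2. The docking identity -/

section Dock

variable {K : Type} [Field K] [NumberField K] {p : ℕ} [Fact p.Prime]
variable {𝒪 : Type} [CommRing 𝒪] [TopologicalSpace 𝒪] {A : Type} [AddCommGroup A] [Module 𝒪 A]
  [TopologicalSpace A] [DiscreteTopology A] [TopologicalSpace (PowerSeries 𝒪)]

/-- **Greenberg's `𝐃|_{Γ_{K_w}}|_{I_w}` IS the K2 kernel's `𝐃|_{localMap K (Sum.inr w)}`** for the descended representation:
`(localRep S (descendUnramified S 𝐃 hS) (Sum.inr w)).restrict (inertiaIncl K w) = 𝐃.restrict (localMap K (Sum.inr w))`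
(`localMap K (Sum.inr w) = (Γ_{K_w} → Γ_K) ∘ (I_w ↪ Γ_{K_w})`, `descendUnramified ∘ toUnramifiedQuot = id` pointwise). [folklore] -/
theorem restrict_localRep_descendUnramified_inertiaIncl (κ : ZpExtension K p)
    (ρ : ContinuousRep (absoluteGaloisGroup K) 𝒪 A) (S : Set (HeightOneSpectrum (𝓞 K)))
    (hS : ramificationSubgroup K S ≤ (AnticyclotomicBigGaloisRep κ ρ).ker) (w : HeightOneSpectrum (𝓞 K)) :
    (Greenberg2016.localRep S (TelescopeK2RepDescent.descendUnramified S (AnticyclotomicBigGaloisRep κ ρ) hS)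
        (Sum.inr w)).restrict (BigGaloisRep.inertiaIncl K w) =
      (AnticyclotomicBigGaloisRep κ ρ).restrict (localMap K (Sum.inr w)) :=
  ContinuousRep.toRepresentation_injective rfl

end Dock

/-! ## §3. (ii′) at an inertia place: `p^a · ker(H¹(K_w, 𝐃) → H¹(I_w, 𝐃))` is almost divisible -/

section Core

variable {K : Type} [Field K] [NumberField K] (p : ℕ) [Fact p.Prime]
  {A : Type} [AddCommGroup A] [Module (IwasawaAlgebra p) A] [TopologicalSpace A] [DiscreteTopology A]
  [TopologicalSpace (IwasawaAlgebra p)] [TopologicalSpace (IwasawaAlgebra₂ p)]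
  [ContinuousSMul (IwasawaAlgebra₂ p) (BigRepModule (IwasawaAlgebra p) p A)]

/-- **Route G′ input (ii′) at an inertia place, by name.** `𝒪 = ℤ_p⟦X⟧`, `B = 𝒪⟦T⟧`; `κ` a `ℤ_p`-extension of `K`;
`ρ : Γ_K → Aut_𝒪(A)` discrete with big module `𝐃` cofinitely generated over `B` (`hD`); `S` a set of finite places with
`ramificationSubgroup K S ≤ ker 𝐃` (`hS`); `w ∤ p`. Then for the unramified local condition
`L_w = ker (H¹(K_w, 𝐃) → H¹(I_w, 𝐃))` of the descended `G_{K,S}`-representation, SOME `p^a · L_w` is almost `B`-divisible: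
(M3) `π : 𝐃^{I_w} ↠ L_w` (`htors` free, §1) fed into (M1)+(M2′)+(M2). [cite: Greenberg2016Selmer, §2.5 p. 8 L35–37, Remark 3.1.2,
§4.2 p. 19 L25–31] [cite: Greenberg2006, Prop. 2.4, §3 A] [cite: Rubin2000, Lemma 1.3.2] -/
theorem exists_isAlmostDivisible_map_lsmul_pow_ker_Hpullback (κ : ZpExtension K p)
    (ρ : ContinuousRep (absoluteGaloisGroup K) (IwasawaAlgebra p) A)
    (hD : Greenberg2006.IsCofinitelyGenerated (IwasawaAlgebra₂ p) (BigRepModule (IwasawaAlgebra p) p A))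
    (S : Set (HeightOneSpectrum (𝓞 K))) (hS : ramificationSubgroup K S ≤ (AnticyclotomicBigGaloisRep κ ρ).ker)
    {w : HeightOneSpectrum (𝓞 K)} (hw : ((p : ℕ) : 𝓞 K) ∉ w.asIdeal) :
    ∃ a : ℕ, Greenberg2016.IsAlmostDivisible (IwasawaAlgebra₂ p)
      ↥((LinearMap.ker ((Greenberg2016.localRep S
          (TelescopeK2RepDescent.descendUnramified S (AnticyclotomicBigGaloisRep κ ρ) hS) (Sum.inr w)).Hpullback
            (BigGaloisRep.inertiaIncl K w) 1)).map
        (LinearMap.lsmul (IwasawaAlgebra₂ p) _ (((p : ℕ) : IwasawaAlgebra₂ p) ^ a))) := by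
  obtain ⟨π, hπ⟩ :=
    TelescopeK2HOneUnramifiedOfInvariants.exists_linearMap_surjective_invariants_ker_Hpullback_localRep S
      (TelescopeK2RepDescent.descendUnramified S (AnticyclotomicBigGaloisRep κ ρ) hS) (fun Φ => isOfFinAddOrder Φ) w
  exact TelescopeK2BigRepInertiaInvariants.exists_isAlmostDivisible_map_lsmul_pow_of_inertia p κ ρ hD hw _ π hπ

end Core

/-! ## §4. The same for the `Sum.inr w` entry of `specOfIndexSet` -/

section Spec

variable {K : Type} [Field K] [NumberField K]

section Shape

variable (S : Set (HeightOneSpectrum (𝓞 K))) {Λ : Type} [CommRing Λ] [TopologicalSpace Λ]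
  {D : Type} [AddCommGroup D] [Module Λ D] [TopologicalSpace D] [DiscreteTopology D] [ContinuousSMul Λ D]
  (ρ : ContinuousRep (GaloisGroupUnramifiedOutside K S) Λ D)

/-- **(M4): at an inertia index the specification IS the unramified kernel.** If `Sum.inr w ∈ L₀` and `Sum.inl w ∉ L₀`
then `specOfIndexSet S ρ L₀ (Sum.inr w) = ker (H¹(K_w, 𝐃) → H¹(I_w, 𝐃))`. [cite: Greenberg2016Selmer, §1 p. 3 L19–25] -/
theorem specOfIndexSet_inr_of_not_mem_of_mem (L₀ : Set (BigGaloisRep.LocalIndex K)) (w : HeightOneSpectrum (𝓞 K))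
    (h₁ : (Sum.inl w : BigGaloisRep.LocalIndex K) ∉ L₀) (h₂ : (Sum.inr w : BigGaloisRep.LocalIndex K) ∈ L₀) :
    TelescopeK2SelmerDictionary.specOfIndexSet S ρ L₀ (Sum.inr w) =
      LinearMap.ker ((Greenberg2016.localRep S ρ (Sum.inr w)).Hpullback (BigGaloisRep.inertiaIncl K w) 1) := by
  refine Submodule.ext fun z => ?_
  rw [TelescopeK2SelmerDictionary.mem_specOfIndexSet_inr_iff]
  exact ⟨fun h => h.2 h₂, fun h => ⟨fun h' => absurd h' h₁, fun _ => h⟩⟩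

/-- In particular for the strict set `strictSet p 𝔮 Σ` at every `w ∉ Σ`, `w ∤ p`, `w ≠ 𝔮`. [cite: Castella2018Erratum, §2] -/
theorem specOfIndexSet_strictSet_inr (p : ℕ) (𝔮 : HeightOneSpectrum (𝓞 K)) (Sig : Set (HeightOneSpectrum (𝓞 K)))
    (w : HeightOneSpectrum (𝓞 K)) (hSig : w ∉ Sig) (hw : ((p : ℕ) : 𝓞 K) ∉ w.asIdeal) (hq : w ≠ 𝔮) :
    TelescopeK2SelmerDictionary.specOfIndexSet S ρ (strictSet p 𝔮 Sig) (Sum.inr w) =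
      LinearMap.ker ((Greenberg2016.localRep S ρ (Sum.inr w)).Hpullback (BigGaloisRep.inertiaIncl K w) 1) :=
  specOfIndexSet_inr_of_not_mem_of_mem S ρ _ w (fun h => hq ((inl_mem_strictSet_iff _ _ _ _).1 h))
    ((inr_mem_strictSet_iff _ _ _ _).2 ⟨hSig, hw⟩)

end Shape

variable (p : ℕ) [Fact p.Prime]
  {A : Type} [AddCommGroup A] [Module (IwasawaAlgebra p) A] [TopologicalSpace A] [DiscreteTopology A]
  [TopologicalSpace (IwasawaAlgebra p)] [TopologicalSpace (IwasawaAlgebra₂ p)]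
  [ContinuousSMul (IwasawaAlgebra₂ p) (BigRepModule (IwasawaAlgebra p) p A)]

/-- **Route G′'s core datum at the inertia indices of a K2 Selmer structure**: for `Sum.inr w ∈ L₀ ∌ Sum.inl w` and `w ∤ p`,
SOME `p^a · 𝓛_w` is almost `B`-divisible, `𝓛 = specOfIndexSet S ρ_S L₀`, `ρ_S` the descended big representation.
[cite: Greenberg2016Selmer, §2.5 p. 8 L35–37, Remark 3.1.2, §4.2 p. 19 L25–31] [cite: Greenberg2006, Prop. 2.4, §3 A] -/
theorem exists_isAlmostDivisible_map_lsmul_pow_specOfIndexSet_inr (κ : ZpExtension K p)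
    (ρ : ContinuousRep (absoluteGaloisGroup K) (IwasawaAlgebra p) A)
    (hD : Greenberg2006.IsCofinitelyGenerated (IwasawaAlgebra₂ p) (BigRepModule (IwasawaAlgebra p) p A))
    (S : Set (HeightOneSpectrum (𝓞 K))) (hS : ramificationSubgroup K S ≤ (AnticyclotomicBigGaloisRep κ ρ).ker)
    (L₀ : Set (BigGaloisRep.LocalIndex K)) {w : HeightOneSpectrum (𝓞 K)} (hw : ((p : ℕ) : 𝓞 K) ∉ w.asIdeal)
    (h₁ : (Sum.inl w : BigGaloisRep.LocalIndex K) ∉ L₀) (h₂ : (Sum.inr w : BigGaloisRep.LocalIndex K) ∈ L₀) :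
    ∃ a : ℕ, Greenberg2016.IsAlmostDivisible (IwasawaAlgebra₂ p)
      ↥((TelescopeK2SelmerDictionary.specOfIndexSet S
          (TelescopeK2RepDescent.descendUnramified S (AnticyclotomicBigGaloisRep κ ρ) hS) L₀ (Sum.inr w)).map
        (LinearMap.lsmul (IwasawaAlgebra₂ p) _ (((p : ℕ) : IwasawaAlgebra₂ p) ^ a))) := by
  rw [specOfIndexSet_inr_of_not_mem_of_mem S _ L₀ w h₁ h₂]
  exact exists_isAlmostDivisible_map_lsmul_pow_ker_Hpullback p κ ρ hD S hS hw

/-- The strict-set instance: `L₀ = strictSet p 𝔭̄ Σ`, every `w ∉ Σ` with `w ∤ p`, `w ≠ 𝔭̄`. [cite: Castella2018Erratum, §2]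
[cite: Greenberg2016Selmer, §4.2 p. 19 L25–31] -/
theorem exists_isAlmostDivisible_map_lsmul_pow_specOfIndexSet_strictSet_inr (κ : ZpExtension K p)
    (ρ : ContinuousRep (absoluteGaloisGroup K) (IwasawaAlgebra p) A)
    (hD : Greenberg2006.IsCofinitelyGenerated (IwasawaAlgebra₂ p) (BigRepModule (IwasawaAlgebra p) p A))
    (S : Set (HeightOneSpectrum (𝓞 K))) (hS : ramificationSubgroup K S ≤ (AnticyclotomicBigGaloisRep κ ρ).ker)
    (𝔮 : HeightOneSpectrum (𝓞 K)) (Sig : Set (HeightOneSpectrum (𝓞 K))) {w : HeightOneSpectrum (𝓞 K)}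
    (hSig : w ∉ Sig) (hw : ((p : ℕ) : 𝓞 K) ∉ w.asIdeal) (hq : w ≠ 𝔮) :
    ∃ a : ℕ, Greenberg2016.IsAlmostDivisible (IwasawaAlgebra₂ p)
      ↥((TelescopeK2SelmerDictionary.specOfIndexSet S
          (TelescopeK2RepDescent.descendUnramified S (AnticyclotomicBigGaloisRep κ ρ) hS) (strictSet p 𝔮 Sig)
            (Sum.inr w)).map
        (LinearMap.lsmul (IwasawaAlgebra₂ p) _ (((p : ℕ) : IwasawaAlgebra₂ p) ^ a))) :=
  exists_isAlmostDivisible_map_lsmul_pow_specOfIndexSet_inr p κ ρ hD S hS _ hw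
    (fun h => hq ((inl_mem_strictSet_iff _ _ _ _).1 h)) ((inr_mem_strictSet_iff _ _ _ _).2 ⟨hSig, hw⟩)

end Spec

end Summit.BirchSwinnertonDyer.BirchSwinnertonDyer.Theorems.TelescopeK2PurityCoreAtInertiaPlaces

end
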